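import Summits.BirchSwinnertonDyer.BirchSwinnertonDyer.Theorems.PlecticLegsArtinBaseChange
import Literature.NumberTheory.EllipticCurves.BSDRootNumberNoContinuationProofs
import Literature.NumberTheory.EllipticCurves.AnalyticRankOverNumberFieldProofs

/-!
# `ArtinBaseChange` (route `PlecticLegs`, stmt-BirchSwinnertonDyer-18261), pointwise form:
# the continuation hypotheses made local, and the `E`-side one discharged by `r_an(E) ≠ 0`

`PlecticLegsArtinBaseChange` proves the support item `ArtinBaseChange` modulo the single named fact
`Literature.NumberTheory.EllipticCurves.hasEntireLFunction_baseChange_fixedField` ("`L(E/F, s)` is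
entire for every elliptic `E/ℚ` and every abelian `F = ℚ(ζ_m)^H`": modularity + base change), a
GLOBAL hypothesis. This file records the sharper POINTWISE statements that the same proved Artin
formalism gives, for one curve `W`, one `m` and one `H` with `F = ℚ(ζ_m)^H`:

* `analyticRank_baseChange_fixedField_eq`: the twisted non-vanishing hypothesis of the item, the
  entire continuation of `L(E_F, s)` AND of `L(E, s)` ⟹ `r_an(E_F) = r_an(E)`;
* `analyticRank_baseChange_fixedField_eq_of_analyticRank_ne_zero`: the `L(E, s)`-continuation
  hypothesis is replaced by `r_an(E) ≠ 0`, which certifies it unconditionally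
  (`WeierstrassCurve.hasEntireLFunction_of_analyticRank_ne_zero`: in the no-continuation branch the
  tree's `analyticRank` is the junk value `0`). This is exactly the situation of the route's deciding
  theorem `closes`, which invokes `ArtinBaseChange` only when `2 ≤ W.analyticRank`;
* `analyticRank_baseChange_fixedField_eq_of_finrank_eq_two`: when `[F : ℚ] = 2` (the regime
  `r_an(E) = 2` of the route) the `L(E_F, s)`-continuation is itself reduced to modularity over `ℚ`
  alone — the summit-wide named fact `WeierstrassCurve.hasEntireLFunction_rat`, applied to `E` and
  to its quadratic twist `E^{(d_F)}` through the tree's proved quadratic Artin formalism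
  (`WeierstrassCurve.hasEntireLFunction_baseChange_of_hasEntireLFunction_rat`) — so in degree `2`
  the item holds modulo `hasEntireLFunction_rat` only.

So the only input of `ArtinBaseChange` that is not proved in the tree is the entire continuation of
`L(E_F, s)` for the ONE field `F` at hand, `(W.baseChange F).HasEntireLFunction` — a genuine input:
without it `(W.baseChange F).analyticRank` is a junk value, and neither mixed case ("`L(E, s)` entire,
`L(E_F, s)` not" or conversely — both vacuous in truth, by BCDT modularity and abelian base change)
is refutable inside the tree, so the item as filed cannot close by a junk-value coincidence either.
-/

noncomputable section

-- D-0017: single-problem summit, so `Summit.BirchSwinnertonDyer.BirchSwinnertonDyer.…` repeats a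
-- namespace BY DESIGN.
set_option linter.dupNamespace false

open scoped Classical
open Complex Filter Topology NumberField

namespace Summit.BirchSwinnertonDyer.BirchSwinnertonDyer.Theorems

set_option backward.isDefEq.respectTransparency false in
/-- **Artin formalism for the analytic rank under abelian base change, pointwise form.** For `E/ℚ`
elliptic (model `W`), `m ≥ 1`, `H ≤ Gal(ℚ(ζ_m)/ℚ)` with fixed field `F = ℚ(ζ_m)^H`: if every
non-trivial Dirichlet character `χ` mod `m` trivial on `H` has an entire continuation `L_χ` of
`∑ χ(n) aₙ(E) n⁻ˢ` with `L_χ(1) ≠ 0`, and if `L(E_F, s)` and `L(E, s)` have entire continuations,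
then `r_an(E_F) = r_an(E)`. Proof: the proved identity
`L(E_F, s) P(s) = L(E, s) Q(s) ∏_{χ ≠ 1} L_χ(s)` on `Re s > 3/2`
(`exists_LSeries_baseChange_fixedField_identity`; `P, Q` Dirichlet polynomials, entire and non-zero
at `1`) extends to `ℂ` by the identity theorem, and orders of vanishing at `1` add up
(`analyticOrderAt_eq_of_mul_eq_mul_prod`). [folklore] -/
theorem analyticRank_baseChange_fixedField_eq (W : WeierstrassCurve ℚ) [W.IsElliptic] (m : ℕ)
    [NeZero m] (H : Subgroup (CyclotomicField m ℚ ≃ₐ[ℚ] CyclotomicField m ℚ))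
    (hχ : ∀ χ : DirichletCharacter ℂ m,
      (∀ σ ∈ H, ∀ a : ℕ, (∀ z : CyclotomicField m ℚ, z ^ m = 1 → σ z = z ^ a) →
        χ (a : ZMod m) = 1) → χ ≠ 1 →
      ∃ L : ℂ → ℂ, Differentiable ℂ L ∧
        (∀ s : ℂ, 2 < s.re → L s = LSeries (fun n ↦ χ n * ((W.LFunction n : ℤ) : ℂ)) s) ∧ L 1 ≠ 0)
    (hWF : (W.baseChange ↥(IntermediateField.fixedField H)).HasEntireLFunction)
    (hW : W.HasEntireLFunction) :
    (W.baseChange ↥(IntermediateField.fixedField H)).analyticRank = W.analyticRank := by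
  haveI : IsCyclotomicExtension {m} ℚ (CyclotomicField m ℚ) :=
    CyclotomicField.isCyclotomicExtension m ℚ
  haveI : IsAbelianGalois ℚ (CyclotomicField m ℚ) :=
    IsCyclotomicExtension.isAbelianGalois {m} ℚ (CyclotomicField m ℚ)
  set F := IntermediateField.fixedField H with hFdef
  -- the Dirichlet-series identity (proved Artin formalism)
  obtain ⟨P, Q, hP, hQ, hP1, hQ1, hPQ⟩ :=
    exists_LSeries_baseChange_fixedField_identity W m (CyclotomicField m ℚ) H
  set X := (Finset.univ.filter (fun χ : DirichletCharacter ℂ m ↦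
    χ ∈ (IsCyclotomicExtension.Rat.subgroupGalEquivSubgroupChar m (CyclotomicField m ℚ) ℂ
      H).ofDual)).erase 1 with hXdef
  -- the twisted continuations, chosen from the hypothesis
  have hLex : ∀ χ ∈ X, ∃ L : ℂ → ℂ, Differentiable ℂ L ∧
      (∀ s : ℂ, 2 < s.re → L s = LSeries (fun n ↦ χ n * ((W.LFunction n : ℤ) : ℂ)) s) ∧
      L 1 ≠ 0 := by
    intro χ hχX
    obtain ⟨hne, hmem⟩ := Finset.mem_erase.mp hχX
    have hmem' : χ ∈ (IsCyclotomicExtension.Rat.subgroupGalEquivSubgroupChar m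
        (CyclotomicField m ℚ) ℂ H).ofDual := (Finset.mem_filter.mp hmem).2
    exact hχ χ (fun σ hσ a ha ↦
      apply_eq_one_of_mem_subgroupChar m (CyclotomicField m ℚ) hmem' hσ ha) hne
  choose! L hLd hLeq hL1 using hLex
  refine congrArg ENat.toNat ?_
  refine analyticOrderAt_eq_of_mul_eq_mul_prod X
    ((W.baseChange ↥F).differentiable_entireLFunction hWF) (W.differentiable_entireLFunction hW)
    hP hQ hLd hP1 hQ1 hL1 fun z hz ↦ ?_
  have hz' : (3 / 2 : ℝ) < z.re := by linarith
  rw [(W.baseChange ↥F).entireLFunction_eq_LSeries hWF hz', W.entireLFunction_eq_LSeries hW hz',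
    hPQ z hz']
  refine congrArg _ (Finset.prod_congr rfl fun χ hχX ↦ ?_)
  exact (hLeq χ hχX z hz).symm

/-- **`ArtinBaseChange` with the `L(E, s)`-continuation discharged by `r_an(E) ≠ 0`.** For `E/ℚ`
elliptic, `m ≥ 1`, `H ≤ Gal(ℚ(ζ_m)/ℚ)`, `F = ℚ(ζ_m)^H`: the twisted non-vanishing hypothesis of the
item, the entire continuation of `L(E_F, s)` and `r_an(E) ≠ 0` imply `r_an(E_F) = r_an(E)`. The
hypothesis `r_an(E) ≠ 0` certifies the entire continuation of `L(E, s)` with no modularity input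
(`WeierstrassCurve.hasEntireLFunction_of_analyticRank_ne_zero`: were there none, the tree's
`analyticRank` would be the junk value `0`); this is the case in which the route's deciding theorem
uses the item (`2 ≤ W.analyticRank`). The remaining hypothesis `(W.baseChange F).HasEntireLFunction`
is the content of the named fact `hasEntireLFunction_baseChange_fixedField` at `(W, m, H)`.
[folklore] -/
theorem analyticRank_baseChange_fixedField_eq_of_analyticRank_ne_zero (W : WeierstrassCurve ℚ)
    [W.IsElliptic] (m : ℕ) [NeZero m] (H : Subgroup (CyclotomicField m ℚ ≃ₐ[ℚ] CyclotomicField m ℚ))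
    (hχ : ∀ χ : DirichletCharacter ℂ m,
      (∀ σ ∈ H, ∀ a : ℕ, (∀ z : CyclotomicField m ℚ, z ^ m = 1 → σ z = z ^ a) →
        χ (a : ZMod m) = 1) → χ ≠ 1 →
      ∃ L : ℂ → ℂ, Differentiable ℂ L ∧
        (∀ s : ℂ, 2 < s.re → L s = LSeries (fun n ↦ χ n * ((W.LFunction n : ℤ) : ℂ)) s) ∧ L 1 ≠ 0)
    (hWF : (W.baseChange ↥(IntermediateField.fixedField H)).HasEntireLFunction)
    (hr : W.analyticRank ≠ 0) :
    (W.baseChange ↥(IntermediateField.fixedField H)).analyticRank = W.analyticRank :=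
  analyticRank_baseChange_fixedField_eq W m H hχ hWF (W.hasEntireLFunction_of_analyticRank_ne_zero hr)

/-- **`ArtinBaseChange` in degree `2`, modulo modularity over `ℚ` only.** For `E/ℚ` elliptic,
`m ≥ 1`, `H ≤ Gal(ℚ(ζ_m)/ℚ)` with QUADRATIC fixed field `F = ℚ(ζ_m)^H` (`[F : ℚ] = 2`): the twisted
non-vanishing hypothesis of the item and the summit-wide named fact
`WeierstrassCurve.hasEntireLFunction_rat` (Breuil–Conrad–Diamond–Taylor 2001, Thm. A) imply
`r_an(E_F) = r_an(E)`. The continuation of `L(E_F, s) = L(E, s) L(E^{(d_F)}, s)` is the tree's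
`WeierstrassCurve.hasEntireLFunction_baseChange_of_hasEntireLFunction_rat` (proved quadratic Artin
formalism, Ireland–Rosen Prop. 20.5.4(b), with `hasEntireLFunction_rat` for `E` and `E^{(d_F)}`);
the rest is `analyticRank_baseChange_fixedField_eq`. This is the regime `r_an(E) = 2` of route
`PlecticLegs`, where no base-change continuation beyond modularity over `ℚ` is needed. [folklore] -/
theorem analyticRank_baseChange_fixedField_eq_of_finrank_eq_two
    (hE : WeierstrassCurve.hasEntireLFunction_rat) (W : WeierstrassCurve ℚ) [W.IsElliptic] (m : ℕ)
    [NeZero m] (H : Subgroup (CyclotomicField m ℚ ≃ₐ[ℚ] CyclotomicField m ℚ))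
    (h2 : Module.finrank ℚ ↥(IntermediateField.fixedField H) = 2)
    (hχ : ∀ χ : DirichletCharacter ℂ m,
      (∀ σ ∈ H, ∀ a : ℕ, (∀ z : CyclotomicField m ℚ, z ^ m = 1 → σ z = z ^ a) →
        χ (a : ZMod m) = 1) → χ ≠ 1 →
      ∃ L : ℂ → ℂ, Differentiable ℂ L ∧
        (∀ s : ℂ, 2 < s.re → L s = LSeries (fun n ↦ χ n * ((W.LFunction n : ℤ) : ℂ)) s) ∧ L 1 ≠ 0) :
    (W.baseChange ↥(IntermediateField.fixedField H)).analyticRank = W.analyticRank :=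
  analyticRank_baseChange_fixedField_eq W m H hχ
    (W.hasEntireLFunction_baseChange_of_hasEntireLFunction_rat ↥(IntermediateField.fixedField H)
      hE h2) (hE W)

-- The item itself follows from the named fact `hasEntireLFunction_baseChange_fixedField` through
-- `analyticRank_baseChange_fixedField_eq` as
-- `fun W _ m _ H hχ ↦ analyticRank_baseChange_fixedField_eq W m H hχ (hX W m H)
--   (hasEntireLFunction_rat_of hX W)`; that reduction is already landed as
-- `artinBaseChange_of_hasEntireLFunction_baseChange_fixedField` and is not restated here.

end Summit.BirchSwinnertonDyer.BirchSwinnertonDyer.Theorems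

end
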